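/-
Origin: expansion seat `planner-pub-hodgecm-prl1-g2-0`, handover #3 2026-08-18T04:59:54Z (`HOME/pub-hodgecm-prl1-g2/lean/Prl1g2/ThetaCarrier.lean`, md5 629c27ba, 450 lines);
landed by the gen-6 packager in gate run 22 as `HodgeCM/Automorphic/ThetaCarrier.lean` (verbatim).
-/
/-
Origin: HOME/pub-hodgecm-prl1-g2/lean/Prl1g2/ThetaCarrier.lean — session planner-pub-hodgecm-prl1-g2-0
(unit pub-hodgecm-prl1-g2, EXPANSION PROVER a-1 gen 2: CONSTRUCT the realisation).
Intended final place (packager's call): `HodgeCM/Automorphic/ThetaCarrier.lean`; module rename `Prl1g2.` ↦ `HodgeCM.Automorphic.`.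
Imports: the LANDED `HodgeCM.Automorphic.ThetaModel` only.  NEW, ADDITIVE; touches no existing file.

KIND: L2 (definitions) + KERNEL.  NOTHING is cited or posited as a fact here.
-/
import Summits.HodgeConjecture.HodgeCM.Automorphic.ThetaModel

set_option autoImplicit false

/-!
# The theta CARRIER: the propositional content of the data binder `T : U.ThetaModel` made explicit

`U.ThetaModel` (gen 1, `HodgeCM.Automorphic.ThetaModel`) is documented as "DATA only", with ONE recorded caveat
(FACTS.md §0, class **data**, rows A1–A3): its fields `core` / `t12` / `t34` are the frozen Prior records
`Perl34.IsolationCore` / `Perl34.TorusData` (`HodgeCM/Prior/Perl34.lean` :101–262), and those records BUNDLE with the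
analytic data the functional-analytic axioms of PerL v5 §3.3 (the isolation theorem's setting):

* `IsolationCore`: `R_unitary`, `hatσ_closed`, `hatσ_invariant`, `hatσ_ortho`, `hatσ_complete`, `eσ_mem`, `eσ_fix`,
  `eσ_selfAdjoint`, `AX9_espectral`, `hatτ_closed`, `hatτ_complete` (11 `Prop` fields);
* `TorusData` (each of the two sides): `S12_def`, `Pw_idem`, `Pw_selfAdjoint`, `AX5b_ϑ_cont`, `AX12_transl_cont`,
  `AX12_E_transl`, `AX12_unfold_lift`, `AX12_molly`, `AX8_annihilation`, `AX9_w_vector` (10 `Prop` fields).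

So every theorem binding `(T : U.ThetaModel)` silently assumes these 31 propositions per seesaw context.  This file
removes the caveat without touching any landed statement:

1. `CoreCarrier` / `TorusCarrier` / `Universe.ThetaCarrier` — genuinely PROP-FREE records (types, operators,
   submodules, index sets, predicates; no field whose type is a proposition, and no hypothesis relocated into a
   subtype: `R` stays a plain `G →* (H →L[ℂ] H)` and its unitarity `R_unitary` stays a NAMED HYPOTHESIS), typed so that
   the DEFINITIONAL part of the axioms — the fields that axiomatise CANONICAL CONSTRUCTIONS — holds BY CONSTRUCTION:
   * the isotypic components are carried as submodules `hatσ i` and USED through their closures `hatσC i`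
     (⟹ `hatσ_closed`; likewise `hatτ_closed`), and the projection `e_σ̂` is DEFINED as Mathlib's orthogonal
     (star) projection onto `hatσC i` (⟹ `eσ_mem`, `eσ_fix`, `eσ_selfAdjoint`, kernel: `Submodule.starProjection_apply_mem`,
     `starProjection_eq_self_iff`, `inner_starProjection_left_eq_right`);
   * the `w`-eigenspace `E_w` (PerL ll. 390–391) is carried as a submodule `Ew` and `P_w` is DEFINED as the orthogonal
     projection onto its closure (⟹ `Pw_idem`, `Pw_selfAdjoint`);
   * `S₁₂` is DEFINED as `closure (span {ϑ_{T,χ}(Φ) : χ allowed, Φ})` (⟹ `S12_def` by `rfl`).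
2. `CoreCarrier.Analytic` / `TorusCarrier.Analytic` / `ThetaCarrier.Analytic` — `Prop`-valued records listing, BY NAME
   and verbatim in meaning, the REMAINING analytic axioms (core: `R_unitary`, `hatσ_invariant`, `hatσ_ortho`,
   `hatσ_complete`, `AX9_espectral`, `hatτ_complete`; per torus side: `AX5b_ϑ_cont`, `AX12_transl_cont`, `AX12_E_transl`,
   `AX12_unfold_lift`, `AX12_molly`, `AX8_annihilation`, `AX9_w_vector`) — 6 + 7 + 7 = 20 per context instead of 31,
   each now a HYPOTHESIS FIELD visible left of the colon, never a property of a data binder.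
3. `CoreCarrier.toIsolationCore (C) (h : C.Analytic)`, `TorusCarrier.toTorusData`, `ThetaModel.ofCarrier (D) (hA)` —
   the frozen Prior records and gen 1's `U.ThetaModel` RECONSTRUCTED from a carrier and its analytic hypotheses, the
   eleven definitional fields (`hatσ_closed`, `eσ_mem`, `eσ_fix`, `eσ_selfAdjoint`, `hatτ_closed`; `S12_def`, `Pw_idem`,
   `Pw_selfAdjoint` on each torus side) discharged by the kernel.  (`Prl1g2/ThetaCarrierFaithful.lean` proves the
   converse — every Prior record arises this way, with the same `R`, `σ̂`, `e_σ̂`, `S₁₂`, `P_w` — so the split is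
   faithful: nothing is weakened, strengthened, or relocated.)  Every landed theorem over `(T : U.ThetaModel)` therefore applies
   verbatim to `T := ThetaModel.ofCarrier D hA`, and an end-state theorem stated over `(D : U.ThetaCarrier) (hA : D.Analytic)`
   has NO propositional content in its data binders (`U`, `D`) — see `Prl1g2/CorCMCarrier.lean`.

Classification of the 20 remaining fields for FACTS.md (commentary, not a citation): `R_unitary` = right Haar
invariance of the measure on `[U(W)]`; `hatσ_invariant/ortho/complete`, `hatτ_complete` = the discrete Hilbert-sum
decomposition of `L²` of the compact quotients `[U(W)]`, `[G_U]` into isotypic components (published background: Gelfand–Graev–Piatetski-Shapiro / Godement's compactness of `R(f)` on a compact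
quotient; PerL ll. 384–387, 264–268); `AX9_espectral` = "e_σ̂ lies in the von Neumann algebra of `R`" (PerL l. 386–387);
the seven torus-side fields = PerL's AX5b / AX12 / AX8 / AX9-at-`w` (ll. 341–455) exactly as typed in the Prior record —
all UNDER ADJUDICATION as typed (class U / PRINT-DERIVED), exactly as FACTS rows A1–A3 already record; this file changes
their VISIBILITY, not their class.
-/

noncomputable section

open scoped InnerProductSpace

namespace HodgeCM

open HodgeCM.Prior.Perl34File HodgeCM.Prior.Perl34File.Perl34

/-! ## 1. The torus-free core -/

/-- **Prop-free carrier of the torus-free core** of PerL v5 §3.3 (cf. `Perl34.IsolationCore`): the same data fields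
WITHOUT the eleven `Prop` fields (`eσ` is not a field: it is defined). -/
structure CoreCarrier (H HG CG G SK SigIdx SigIdxG : Type)
    [NormedAddCommGroup H] [InnerProductSpace ℂ H] [CompleteSpace H]
    [NormedAddCommGroup HG] [InnerProductSpace ℂ HG] [CompleteSpace HG]
    [NormedAddCommGroup CG] [NormedSpace ℂ CG]
    [Group G] [TopologicalSpace G] [TopologicalSpace SK] where
  /-- AX9 (l. 382–383): the right regular representation `R` of `U(W)(𝔸)` on `L²([U(W)])`, as a monoid morphism into
  the bounded operators (its unitarity is the hypothesis `Analytic.R_unitary`, not part of the carrier). -/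
  R : G →* (H →L[ℂ] H)
  /-- the Weil action `ω(h)` on the index set `𝒮^κ` (ll. 418, 344–345) -/
  omg : G → SK → SK
  /-- the theta kernel operators `𝒯_Φ : L²([U(W)]) → C([G_U])` (ll. 380–383) -/
  TΦc : SK → (H →L[ℂ] CG)
  /-- the bounded inclusion `C([G_U]) ⊆ L²([G_U])` -/
  inclCG : CG →L[ℂ] HG
  /-- AX9 (ll. 384–387): the isotypic components `σ̂` of `L²([U(W)])` (used through their closures `hatσC`) -/
  hatσ : SigIdx → Submodule ℂ H
  /-- AX1b(a): the isotypic components of `L²([G_U])` (used through their closures `hatτC`) -/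
  hatτ : SigIdxG → Submodule ℂ HG

namespace CoreCarrier

variable {H HG CG G SK SigIdx SigIdxG : Type}
variable [NormedAddCommGroup H] [InnerProductSpace ℂ H] [CompleteSpace H]
variable [NormedAddCommGroup HG] [InnerProductSpace ℂ HG] [CompleteSpace HG]
variable [NormedAddCommGroup CG] [NormedSpace ℂ CG]
variable [Group G] [TopologicalSpace G] [TopologicalSpace SK]
variable (C : CoreCarrier H HG CG G SK SigIdx SigIdxG)

/-- The CLOSED isotypic component `σ̂` (closure of the carried submodule). -/
def hatσC (i : SigIdx) : Submodule ℂ H := (C.hatσ i).topologicalClosure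

/-- The CLOSED `G_U`-side isotypic component. -/
def hatτC (j : SigIdxG) : Submodule ℂ HG := (C.hatτ j).topologicalClosure

/-- (Ported verbatim from the HodgeCMPerL package; no docstring in the source.) -/
theorem hatσC_closed (i : SigIdx) : IsClosed (C.hatσC i : Set H) := Submodule.isClosed_topologicalClosure _

/-- (Ported verbatim from the HodgeCMPerL package; no docstring in the source.) -/
theorem hatτC_closed (j : SigIdxG) : IsClosed (C.hatτC j : Set HG) := Submodule.isClosed_topologicalClosure _

/-- (Ported verbatim from the HodgeCMPerL package; no docstring in the source.) -/
instance (i : SigIdx) : (C.hatσC i).HasOrthogonalProjection := by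
  unfold hatσC; infer_instance

/-- **The orthogonal projection `e_σ̂`** (AX9, l. 386), DEFINED as Mathlib's star projection onto `hatσC i`. -/
def eσ (i : SigIdx) : H →L[ℂ] H := (C.hatσC i).starProjection

/-- (Ported verbatim from the HodgeCMPerL package; no docstring in the source.) -/
theorem eσ_mem (i : SigIdx) (v : H) : C.eσ i v ∈ C.hatσC i := Submodule.starProjection_apply_mem _ v

/-- (Ported verbatim from the HodgeCMPerL package; no docstring in the source.) -/
theorem eσ_fix (i : SigIdx) (v : H) (hv : v ∈ C.hatσC i) : C.eσ i v = v :=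
  Submodule.starProjection_eq_self_iff.mpr hv

/-- (Ported verbatim from the HodgeCMPerL package; no docstring in the source.) -/
theorem eσ_selfAdjoint (i : SigIdx) (u v : H) : ⟪C.eσ i u, v⟫_ℂ = ⟪u, C.eσ i v⟫_ℂ :=
  Submodule.inner_starProjection_left_eq_right _ u v

/-- The `L²`-valued theta kernel operator `𝒯_Φ : L²([U(W)]) → L²([G_U])` (= `IsolationCore.TΦ` of the
reconstructed core, by `rfl`). -/
def TΦ (Φ : SK) : H →L[ℂ] HG := C.inclCG.comp (C.TΦc Φ)

/-- `M` is an `R(U(W)(𝔸))`-invariant submodule. -/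
def Invariant (M : Submodule ℂ H) : Prop := ∀ (g : G), ∀ v ∈ M, C.R g v ∈ M

/-- **The remaining analytic axioms of the core** (6 of the 11 `Prop` fields of `Perl34.IsolationCore`; the other five
hold by construction).  Each field is verbatim the Prior field, stated for the closed components `hatσC` / `hatτC` and
the defined projection `eσ`. -/
structure Analytic : Prop where
  /-- AX9 (l. 382–383): `R` is unitary — each `R g` preserves the inner product (right Haar invariance on the compact
  quotient `[U(W)]`). -/
  R_unitary : ∀ (g : G) (u v : H), ⟪C.R g u, C.R g v⟫_ℂ = ⟪u, v⟫_ℂ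
  /-- AX9 (l. 385–386): each `σ̂` is an `R(U(W)(𝔸))`-subrepresentation (stated for the carried submodule; it passes to
  the closure, `hatσC_invariant`). -/
  hatσ_invariant : ∀ i (g : G), ∀ v ∈ C.hatσ i, C.R g v ∈ C.hatσ i
  /-- AX9 (l. 384–385): distinct isotypic components are orthogonal. -/
  hatσ_ortho : ∀ i j, i ≠ j → ∀ u ∈ C.hatσC i, ∀ v ∈ C.hatσC j, ⟪u, v⟫_ℂ = 0
  /-- AX9 (l. 384–385): completeness — `L²([U(W)])` is the Hilbert sum of its isotypic components. -/
  hatσ_complete : (⨆ i, C.hatσ i).topologicalClosure = ⊤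
  /-- AX9 (ll. 386–387): "the orthogonal projection `e_σ̂` lies in the von Neumann algebra generated by `R(U(W)(𝔸))`,
  hence preserves every closed `R`-invariant subspace" — the consumed consequence, verbatim. -/
  AX9_espectral : ∀ (M : Submodule ℂ H), IsClosed (M : Set H) → C.Invariant M → ∀ i, ∀ v ∈ M, C.eσ i v ∈ M
  /-- AX1b(a) (ll. 264–268): completeness of the `G_U`-side decomposition. -/
  hatτ_complete : (⨆ j, C.hatτ j).topologicalClosure = ⊤

variable {C}

/-- (Ported verbatim from the HodgeCMPerL package; no docstring in the source.) -/
theorem hatσC_invariant (h : C.Analytic) (i : SigIdx) (g : G) (v : H) (hv : v ∈ C.hatσC i) :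
    C.R g v ∈ C.hatσC i := by
  -- the continuous operator `R g` maps the closure of an invariant submodule into the closure
  rw [hatσC, ← SetLike.mem_coe, Submodule.topologicalClosure_coe] at hv ⊢
  exact map_mem_closure (C.R g).continuous hv (fun w hw => h.hatσ_invariant i g w hw)

/-- (Ported verbatim from the HodgeCMPerL package; no docstring in the source.) -/
theorem hatσC_complete (h : C.Analytic) : (⨆ i, C.hatσC i).topologicalClosure = ⊤ := by
  apply top_unique
  rw [← h.hatσ_complete]
  exact Submodule.topologicalClosure_mono (iSup_mono fun i => Submodule.le_topologicalClosure _)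

/-- (Ported verbatim from the HodgeCMPerL package; no docstring in the source.) -/
theorem hatτC_complete (h : C.Analytic) : (⨆ j, C.hatτC j).topologicalClosure = ⊤ := by
  apply top_unique
  rw [← h.hatτ_complete]
  exact Submodule.topologicalClosure_mono (iSup_mono fun j => Submodule.le_topologicalClosure _)

variable (C)

/-- **The frozen Prior record reconstructed**: `Perl34.IsolationCore` from a carrier and its six analytic hypotheses;
the five definitional `Prop` fields (`hatσ_closed`, `eσ_mem`, `eσ_fix`, `eσ_selfAdjoint`, `hatτ_closed`) are kernel
theorems. -/
def toIsolationCore (h : C.Analytic) : Perl34.IsolationCore H HG CG G SK SigIdx SigIdxG where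
  R := C.R
  R_unitary := h.R_unitary
  omg := C.omg
  TΦc := C.TΦc
  inclCG := C.inclCG
  hatσ := C.hatσC
  hatσ_closed := C.hatσC_closed
  hatσ_invariant := fun i g v hv => hatσC_invariant h i g v hv
  hatσ_ortho := h.hatσ_ortho
  hatσ_complete := hatσC_complete h
  eσ := C.eσ
  eσ_mem := C.eσ_mem
  eσ_fix := C.eσ_fix
  eσ_selfAdjoint := C.eσ_selfAdjoint
  AX9_espectral := fun M hM hinv i v hv => h.AX9_espectral M hM hinv i v hv
  hatτ := C.hatτC
  hatτ_closed := C.hatτC_closed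
  hatτ_complete := hatτC_complete h

/-- (Ported verbatim from the HodgeCMPerL package; no docstring in the source.) -/
@[simp] theorem toIsolationCore_R (h : C.Analytic) : (C.toIsolationCore h).R = C.R := rfl
/-- (Ported verbatim from the HodgeCMPerL package; no docstring in the source.) -/
@[simp] theorem toIsolationCore_hatσ (h : C.Analytic) : (C.toIsolationCore h).hatσ = C.hatσC := rfl
/-- (Ported verbatim from the HodgeCMPerL package; no docstring in the source.) -/
@[simp] theorem toIsolationCore_eσ (h : C.Analytic) : (C.toIsolationCore h).eσ = C.eσ := rfl
/-- (Ported verbatim from the HodgeCMPerL package; no docstring in the source.) -/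
@[simp] theorem toIsolationCore_TΦ (h : C.Analytic) (Φ : SK) :
    (C.toIsolationCore h).TΦ Φ = C.inclCG.comp (C.TΦc Φ) := rfl

end CoreCarrier

/-! ## 2. One torus side -/

/-- **Prop-free carrier of one torus side** `(T, w)` of PerL v5 §3.3 (cf. `Perl34.TorusData`): the same data fields
WITHOUT the ten `Prop` fields; `S₁₂` and `P_w` are not fields (they are defined: `S12`, `Pw`), the `w`-eigenspace
`E_w` (ll. 390–391) is carried instead of its projection. -/
structure TorusCarrier {H HG CG G SK SigIdx SigIdxG : Type}
    [NormedAddCommGroup H] [InnerProductSpace ℂ H] [CompleteSpace H]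
    [NormedAddCommGroup HG] [InnerProductSpace ℂ HG] [CompleteSpace HG]
    [NormedAddCommGroup CG] [NormedSpace ℂ CG]
    [Group G] [TopologicalSpace G] [TopologicalSpace SK]
    (C : CoreCarrier H HG CG G SK SigIdx SigIdxG) where
  /-- the characters `χ` of `[T]` with `χ_∞ = w` (ll. 398–400) — bare index type -/
  X : Type
  /-- the test functions `f ∈ C_c^∞(U(W)(𝔸))` (l. 405–406) — bare index type -/
  TestFn : Type
  /-- Def 3.2 + ll. 345–346: `χ` arises from an allowed pair -/
  allowed : X → Prop
  /-- the toric periods `ϑ_{T,χ}(Φ) ∈ C([G_U])` (ll. 345–347) -/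
  ϑc : X → SK → CG
  /-- AX12 (ll. 405–411): the pseudo-Eisenstein vectors `E^χ_f` -/
  E : X → TestFn → H
  /-- ll. 390–391: the `w`-eigenspace `E_w` of `T(L₀⊗ℝ)` in `L²([U(W)])` (used through its closure `EwC`; `P_w` is
  DEFINED as the orthogonal projection onto it) -/
  Ew : Submodule ℂ H
  /-- ll. 387–390: "`w` occurs in `σ_∞|_{T(L₀⊗ℝ)}`" on isotypic components -/
  wOccurs : SigIdx → Prop
  /-- l. 410: the test-function twist `f ↦ f^{h₀}` -/
  ETransl : G → X → TestFn → TestFn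

namespace TorusCarrier

variable {H HG CG G SK SigIdx SigIdxG : Type}
variable [NormedAddCommGroup H] [InnerProductSpace ℂ H] [CompleteSpace H]
variable [NormedAddCommGroup HG] [InnerProductSpace ℂ HG] [CompleteSpace HG]
variable [NormedAddCommGroup CG] [NormedSpace ℂ CG]
variable [Group G] [TopologicalSpace G] [TopologicalSpace SK]
variable {C : CoreCarrier H HG CG G SK SigIdx SigIdxG} (D : TorusCarrier C)

/-- **`S₁₂` by definition** (ll. 348–349): `closure (span {ϑ_{T,χ}(Φ) : χ allowed, Φ ∈ 𝒮^κ})` in `L²([G_U])`. -/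
def S12 : Submodule ℂ HG :=
  (Submodule.span ℂ {u : HG | ∃ χ, D.allowed χ ∧ ∃ Φ : SK, u = C.inclCG (D.ϑc χ Φ)}).topologicalClosure

/-- The CLOSED `w`-eigenspace. -/
def EwC : Submodule ℂ H := D.Ew.topologicalClosure

/-- (Ported verbatim from the HodgeCMPerL package; no docstring in the source.) -/
instance : D.EwC.HasOrthogonalProjection := by
  unfold EwC; infer_instance

/-- **`P_w` by definition** (ll. 390–391): the orthogonal (star) projection onto the closed `w`-eigenspace. -/
def Pw : H →L[ℂ] H := D.EwC.starProjection

/-- `Pw_idem` by construction. -/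
theorem Pw_idem : D.Pw.comp D.Pw = D.Pw :=
  (Submodule.isIdempotentElem_starProjection D.EwC).eq

/-- `Pw_selfAdjoint` by construction. -/
theorem Pw_selfAdjoint (u v : H) : ⟪D.Pw u, v⟫_ℂ = ⟪u, D.Pw v⟫_ℂ :=
  Submodule.inner_starProjection_left_eq_right _ u v

/-- (Ported verbatim from the HodgeCMPerL package; no docstring in the source.) -/
theorem Pw_eq_self_iff (v : H) : D.Pw v = v ↔ v ∈ D.EwC := Submodule.starProjection_eq_self_iff

/-- `ϑ_{T,χ}(Φ)` viewed in `L²([G_U])`. -/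
def ϑ (χ : D.X) (Φ : SK) : HG := C.inclCG (D.ϑc χ Φ)

/-- **The remaining analytic axioms of one torus side** (7 of the 10 `Prop` fields of `Perl34.TorusData`; `S12_def`,
`Pw_idem`, `Pw_selfAdjoint` hold by construction).  Verbatim the Prior fields, over the carrier's `R`, `𝒯_Φ`, `hatσC`
and the defined `P_w`. -/
structure Analytic : Prop where
  /-- AX5b (ll. 341–346, 356–358): `Φ ↦ ϑ_{T,χ}(Φ)` is continuous into `C([G_U])`. -/
  AX5b_ϑ_cont : ∀ χ, Continuous (D.ϑc χ)
  /-- AX12 (ll. 394–396): `h ↦ ϑ_{T,χ}(ω(h)Φ)` is continuous `U(W)(𝔸) → C([G_U])`. -/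
  AX12_transl_cont : ∀ χ (Φ : SK), Continuous fun h : G => D.ϑc χ (C.omg h Φ)
  /-- ll. 410–411: `R(h₀) E^χ_f = E^χ_{f^{h₀}}`. -/
  AX12_E_transl : ∀ (h : G) χ f, C.R h (D.E χ f) = D.E χ (D.ETransl h χ f)
  /-- AX12, first unfolding identity (ll. 405–421, Prop 3.6 Step 1), integral-free. -/
  AX12_unfold_lift : ∀ (Φ : SK) χ f, (C.TΦ Φ) (D.E χ f) ∈ (Submodule.span ℂ
    (Set.range fun h : G => C.inclCG (D.ϑc χ (C.omg h Φ)))).topologicalClosure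
  /-- AX12 + AX5b, the approximate-identity limit of Thm 3.7's proof (ll. 453–455). -/
  AX12_molly : ∀ χ (Φ : SK),
    C.inclCG (D.ϑc χ Φ) ∈ closure (Set.range fun f : D.TestFn => (C.TΦ Φ) (D.E χ f))
  /-- COMPOSITE FIELD = Prop 3.6 Step 2 (ll. 423–434): a vector orthogonal to every `E^χ_f` has vanishing
  `w`-isotypic part. -/
  AX8_annihilation : ∀ v : H, (∀ χ f, ⟪D.E χ f, v⟫_ℂ = 0) → D.Pw v = 0
  /-- AX9 at `w` (ll. 435–437): a nonzero closed `R`-invariant subspace meeting a `σ̂` whose type contains `w`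
  contains a nonzero `P_w`-fixed vector of that `σ̂`. -/
  AX9_w_vector : ∀ (M : Submodule ℂ H), IsClosed (M : Set H) → C.Invariant M → ∀ i, D.wOccurs i →
    M ⊓ C.hatσC i ≠ ⊥ → ∃ v ∈ M ⊓ C.hatσC i, v ≠ 0 ∧ D.Pw v = v

/-- **The frozen Prior record reconstructed**: `Perl34.TorusData` over the reconstructed core, from a torus carrier and
its seven analytic hypotheses; `S12_def`, `Pw_idem`, `Pw_selfAdjoint` are kernel theorems (`rfl` / Mathlib). -/
def toTorusData (h : C.Analytic) (hD : D.Analytic) : Perl34.TorusData (C.toIsolationCore h) where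
  X := D.X
  TestFn := D.TestFn
  allowed := D.allowed
  ϑc := D.ϑc
  E := D.E
  S12 := D.S12
  S12_def := rfl
  wOccurs := D.wOccurs
  Pw := D.Pw
  Pw_idem := D.Pw_idem
  Pw_selfAdjoint := D.Pw_selfAdjoint
  AX5b_ϑ_cont := hD.AX5b_ϑ_cont
  AX12_transl_cont := hD.AX12_transl_cont
  ETransl := D.ETransl
  AX12_E_transl := hD.AX12_E_transl
  AX12_unfold_lift := hD.AX12_unfold_lift
  AX12_molly := hD.AX12_molly
  AX8_annihilation := hD.AX8_annihilation
  AX9_w_vector := hD.AX9_w_vector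

/-- (Ported verbatim from the HodgeCMPerL package; no docstring in the source.) -/
@[simp] theorem toTorusData_S12 (h : C.Analytic) (hD : D.Analytic) : (D.toTorusData h hD).S12 = D.S12 := rfl
/-- (Ported verbatim from the HodgeCMPerL package; no docstring in the source.) -/
@[simp] theorem toTorusData_Pw (h : C.Analytic) (hD : D.Analytic) : (D.toTorusData h hD).Pw = D.Pw := rfl
/-- (Ported verbatim from the HodgeCMPerL package; no docstring in the source.) -/
@[simp] theorem toTorusData_X (h : C.Analytic) (hD : D.Analytic) : (D.toTorusData h hD).X = D.X := rfl
/-- (Ported verbatim from the HodgeCMPerL package; no docstring in the source.) -/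
@[simp] theorem toTorusData_allowed (h : C.Analytic) (hD : D.Analytic) :
    (D.toTorusData h hD).allowed = D.allowed := rfl
/-- (Ported verbatim from the HodgeCMPerL package; no docstring in the source.) -/
@[simp] theorem toTorusData_wOccurs (h : C.Analytic) (hD : D.Analytic) :
    (D.toTorusData h hD).wOccurs = D.wOccurs := rfl
/-- (Ported verbatim from the HodgeCMPerL package; no docstring in the source.) -/
theorem toTorusData_ϑ (h : C.Analytic) (hD : D.Analytic) (χ : D.X) (Φ : SK) :
    (D.toTorusData h hD).ϑ χ Φ = D.ϑ χ Φ := rfl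

end TorusCarrier

/-! ## 3. The theta carrier of a universe and the reconstructed theta model -/

namespace Universe

variable (U : Universe)


-- port_pkg: scope closed for this part
end Universe
end HodgeCM
end
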